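import Literature.AnabelianGeometry.EtaleTheta.FrobenioidKummerOut
import Literature.AnabelianGeometry.EtaleTheta.Discharge.Sec5BiThetaIso
import Literature.AnabelianGeometry.EtaleTheta.Discharge.Sec2EnvelopeLemmas

/-!
# [EtTh] §5, Lemma 5.8 / 5.9 (iv): the `K^×`-part of `D` is carried onto the Kummer part of `D_Y` — proofs (pp. 331–332 / PDF pp. 105–106)

Mochizuki, *The étale theta function and its Frobenioid-theoretic manifestations*, Publ. RIMS **45**
(2009) [cite: MochizukiEtTh2009, Lem 5.9 (iv) p.332 (PDF p.106)].  Layer L2 of the abc-iut cell, seat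
abc-iut-L2-t11 (gen 2).  PROOF-ONLY companion (no definitions) of `FrobenioidKummerOut.lean` (this seat: the
`K^×`-part `BiratAutAction.kummerOut` of `D ⊆ Out(E^Π_N)`, MERGE-PLAN row 11 of abc-iut-L2-t4) over
abc-iut-L2-t4's `FrobenioidMonoThetaEnv.lean` / `FrobenioidEnvelopeIso.lean` and this seat's
`Discharge/Sec5EnvelopeTopology.lean`, `Discharge/Sec5BiThetaIso.lean`.

PROVED here:
* `coe_kummerEnd_unit`, `constOut_subset_kummerOut` — for `u ∈ (O_K^×)^{1/N}` "conjugation by `u`" IS abc-iut-L2-t4's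
  `constOut` generator (conjugation by `(u, 1)`); `kummerOutHom_eq_one_of_mem_muTorsion` — `μ_N(B_N)` acts by
  INNER automorphisms (Lemma 5.8: the outer action is one of "`(K^×)^{1/N}/μ_N(B_N)`");
* `isEnvCocycle_kummerCocycleY`, `envIso_kummerEnd`, `congr_kummerAutHom_eq_shift` — the Kummer cocycle of
  `f ∈ (K^×)^{1/N}` read on `Π^tp_Y` is a 1-cocycle for the cyclotomic character, and **under `E^Π_N ⥲ Π^tp_Y[μ_N]`
  (Lemma 5.9 (iv)) "conjugation by `f`" IS abc-iut-L2-t2's cocycle shift `CycEnvelope.shift`** by its inverse;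
* `image_kummerOut_subset_DY`, `constOutTransported_birat` — hence the `K^×`-part of `D` goes INTO the Kummer part
  `kummerOut` of `D_Y` ("the image of `K^×`", Def. 2.13 (i), p.273 (PDF p.47)) as soon as each such cocycle is
  INFLATED FROM `G_K` (hypothesis `hinfl`; proof of Lemma 5.8: "`Π^tp_Y` [i.e., `G_K`, via the natural surjection
  `Π^tp_Y ↠ G_K`] acts …", "since `Y` is geometrically connected over `K`"): `ConstOutTransported` HOLDS at
  `DK := kummerOut`;
* `kummerOutReached_birat` — `KummerOutReached` (every Kummer shift of `D_Y` is reached from `D`) HOLDS at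
  `DK := kummerOut` as soon as every `μ_N`-valued class of `G_K` is the Kummer class of an `N`-th root of a
  constant (hypothesis `hKum`; p.273 (PDF p.47): "`K^× ↠ (K^×)/(K^×)^N ⥲ H¹(G_K, μ_N)` — where the '`⥲`' is the
  Kummer map", together with Lemma 5.8 "`(K^×)^{1/N}/μ_N(B_N) ⥲ K^×`");
* `envIsoBiTheta_birat`, `frdIsMonoThetaEnv_birat` — abc-iut-L2-t4's Lemma 5.9 (iv) named facts `EnvIsoBiTheta` /
  `FrdIsMonoThetaEnv` at the HONEST `DK := kummerOut`, DISCHARGED MODULO: `Facts`, the identifications `ι`, `m`,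
  `CyclotomicCharacterCompatX`, the Prop. 5.2 (iii) dictionary `ThetaSectionCompat`, the birational action
  `BiratAutAction`, `KxRootNModCyclotome`, and the arithmetic inputs `hinfl`, `hKum` (Kummer theory of `K`) —
  replacing the reading `DK := ∅`, under which `KummerOutReached` fails in the genuine situation (MERGE-PLAN row 11).
HONEST FRAMING: discharges MODULO the hypotheses named in each statement; [EtTh] is refereed; nothing of it
is asserted unconditionally; typed ≠ proved; no side is taken on any disputed claim downstream.
-/

namespace Literature.AnabelianGeometry.EtaleTheta

open CategoryTheory

universe w v v' u u'

/-! ### A generic fact on envelope cocycles (the group-law facts are abc-iut-L2-t10's `Sec2EnvelopeLemmas`) -/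

namespace CycEnvelope

variable {P G μ : Type*} [Group P] [Group G] [CommGroup μ] {aug : P →* G} {χ : G →* MulAut μ}

/-- Cocycles are stable under pointwise equality (bookkeeping). [cite: MochizukiEtTh2009, Prop 2.14(ii) p.49] -/
theorem IsEnvCocycle.congr {δ δ' : P → μ} (hδ : IsEnvCocycle aug χ δ) (h : ∀ p, δ p = δ' p) :
    IsEnvCocycle aug χ δ' := by
  obtain rfl : δ = δ' := funext h
  exact hδ

end CycEnvelope

namespace ThetaFrobenioid

variable {C : Type u} [Category.{v} C] {D : Type u'} [Category.{v'} D] {𝔉 : ThetaFrobenioid.{w} C D}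

/-- `μ_N(B_N) ⊆ (K^×)^{1/N}` (its `N`-th powers are `1 ∈ K^×`). [cite: MochizukiEtTh2009, Lem 5.8 p.331 (PDF p.105)] -/
theorem muToBirat_mem_KxRootN (𝔉 : ThetaFrobenioid.{w} C D) (u : 𝔉.muTorsion 𝔉.BN 𝔉.N) : 𝔉.muToBirat u ∈ 𝔉.KxRootN := by
  rw [𝔉.mem_KxRootN, ← map_pow]
  have hu : u ^ (𝔉.N : ℕ) = 1 := Subtype.ext (by rw [Subgroup.coe_pow, Subgroup.coe_one]; exact u.2.2)
  rw [hu, map_one]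
  exact one_mem _

namespace BiratAutAction

variable (α : 𝔉.BiratAutAction)

/-! ### `(O_K^×)^{1/N}` acts as abc-iut-L2-t4's `constOut`; `μ_N(B_N)` acts innerly -/

/-- `κ_f` of a constant unit `u ∈ (O_K^×)^{1/N}`: `κ_u(e) = e ∘ u ∘ e⁻¹ ∘ u⁻¹`, the inverse of the commutator by which
abc-iut-L2-t4's `constOut` acts (`Discharge/Sec5ConstantsKummer.lean`). [cite: MochizukiEtTh2009, Lem 5.8 p.331 (PDF p.105)] -/
theorem coe_kummerCocycle_unit (hK : 𝔉.KxRootNModCyclotome) (u : 𝔉.units 𝔉.BN)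
    (hf : 𝔉.unitsToBirat 𝔉.BN u ∈ 𝔉.KxRootN) (e : Aut 𝔉.BN) :
    ((α.kummerCocycle hK ⟨_, hf⟩ e : 𝔉.muTorsion 𝔉.BN 𝔉.N) : Aut 𝔉.BN) =
      e * (u : Aut 𝔉.BN) * e⁻¹ * (u : Aut 𝔉.BN)⁻¹ := by
  have hmem : e * (u : Aut 𝔉.BN) * e⁻¹ * (u : Aut 𝔉.BN)⁻¹ ∈ 𝔉.units 𝔉.BN :=
    (𝔉.units 𝔉.BN).mul_mem ((𝔉.units_normal 𝔉.BN).conj_mem _ u.2 e) ((𝔉.units 𝔉.BN).inv_mem u.2)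
  have key : 𝔉.muToBirat (α.kummerCocycle hK ⟨_, hf⟩ e) = 𝔉.unitsToBirat 𝔉.BN ⟨_, hmem⟩ := by
    rw [α.muToBirat_kummerCocycle]
    change α.act e (𝔉.unitsToBirat 𝔉.BN u) * (𝔉.unitsToBirat 𝔉.BN u)⁻¹ = _
    rw [α.act_unitsToBirat, ← map_inv, ← map_mul]
    rfl
  exact congrArg Subtype.val (𝔉.unitsToBirat_injective 𝔉.BN key)

/-- **For a constant unit `u ∈ (O_K^×)^{1/N}`, "conjugation by `u`" IS conjugation by `(u, 1)`**:
`kummerEnd u (e, y) = (u ∘ e ∘ u⁻¹, y)` (abc-iut-L2-t4's `constOut`). [cite: MochizukiEtTh2009, Lem 5.8 p.331 (PDF p.105)] -/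
theorem coe_kummerEnd_unit (hK : 𝔉.KxRootNModCyclotome) (u : 𝔉.units 𝔉.BN)
    (hf : 𝔉.unitsToBirat 𝔉.BN u ∈ 𝔉.KxRootN) (x : 𝔉.EPiN) :
    ((α.kummerEnd hK ⟨_, hf⟩ x : 𝔉.EPiN) : Aut 𝔉.BN × 𝔉.PiX) =
      ((u : Aut 𝔉.BN), (1 : 𝔉.PiX)) * (x : Aut 𝔉.BN × 𝔉.PiX) * ((u : Aut 𝔉.BN), (1 : 𝔉.PiX))⁻¹ := by
  rw [coe_kummerEnd, α.coe_kummerCocycle_unit hK u hf]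
  refine Prod.ext ?_ ?_
  · change (x.1.1 * (u : Aut 𝔉.BN) * x.1.1⁻¹ * (u : Aut 𝔉.BN)⁻¹)⁻¹ * x.1.1 =
      (u : Aut 𝔉.BN) * x.1.1 * (u : Aut 𝔉.BN)⁻¹
    group
  · change x.1.2 = 1 * x.1.2 * 1⁻¹
    rw [one_mul, inv_one, mul_one]

/-- **`constOut ⊆ kummerOut`**: abc-iut-L2-t4's outer action of `(O_K^×)^{1/N}` (`constOut`) lies in the `K^×`-part —
the printed "extends" of Lemma 5.8; so `⟨galOut ∪ constOut ∪ kummerOut⟩ = ⟨galOut ∪ kummerOut⟩`.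
[cite: MochizukiEtTh2009, Lem 5.8 p.331 (PDF p.105)] -/
theorem constOut_subset_kummerOut (hK : 𝔉.KxRootNModCyclotome) (h8 : 𝔉.ConstantsEqNormalizer) :
    𝔉.constOut h8 ⊆ α.kummerOut hK := by
  rintro _ ⟨u, rfl⟩
  obtain ⟨u₀, hu₀, hu₀'⟩ := u.2
  have hf : 𝔉.unitsToBirat 𝔉.BN u₀ ∈ 𝔉.KxRootN := hu₀
  refine ⟨⟨_, hf⟩, ?_⟩
  rw [kummerOutHom_apply]
  change TopOut.mk _ _ = TopOut.mk _ _
  congr 1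
  apply Subtype.ext
  apply MulEquiv.ext
  intro x
  apply Subtype.ext
  change ((α.kummerEnd hK ⟨_, hf⟩ x : 𝔉.EPiN) : Aut 𝔉.BN × 𝔉.PiX) =
    (((u : Aut 𝔉.BN), (1 : 𝔉.PiX)) * (x : Aut 𝔉.BN × 𝔉.PiX) * ((u : Aut 𝔉.BN), (1 : 𝔉.PiX))⁻¹)
  rw [α.coe_kummerEnd_unit hK u₀ hf x, ← hu₀']
  rfl

/-- **`μ_N(B_N)` acts by inner automorphisms**: for `u ∈ μ_N(B_N)`, "conjugation by `u`" on `E^Π_N` is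
conjugation by the element `(u, 1) ∈ E^Π_N` (abc-iut-L2-t4's `muIncl u`), whence trivial in `Out(E^Π_N)` —
the outer action of Lemma 5.8 is one of "`(K^×)^{1/N}/μ_N(B_N)`".  [cite: MochizukiEtTh2009, Lem 5.8 p.331 (PDF p.105)] -/
theorem kummerOutHom_eq_one_of_mem_muTorsion (hK : 𝔉.KxRootNModCyclotome) (u : 𝔉.muTorsion 𝔉.BN 𝔉.N) :
    α.kummerOutHom hK ⟨_, 𝔉.muToBirat_mem_KxRootN u⟩ = 1 := by
  rw [kummerOutHom_apply]
  refine (QuotientGroup.eq_one_iff _).mpr ?_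
  rw [Subgroup.mem_subgroupOf]
  refine ⟨𝔉.muIncl u, ?_⟩
  apply MulEquiv.ext
  intro x
  apply Subtype.ext
  change (((Subgroup.inclusion (𝔉.muTorsion_le_units 𝔉.BN 𝔉.N) u : 𝔉.units 𝔉.BN) : Aut 𝔉.BN),
        (1 : 𝔉.PiX)) * (x : Aut 𝔉.BN × 𝔉.PiX) *
      (((Subgroup.inclusion (𝔉.muTorsion_le_units 𝔉.BN 𝔉.N) u : 𝔉.units 𝔉.BN) : Aut 𝔉.BN),
        (1 : 𝔉.PiX))⁻¹ =
    ((α.kummerEnd hK ⟨_, 𝔉.muToBirat_mem_KxRootN u⟩ x : 𝔉.EPiN) : Aut 𝔉.BN × 𝔉.PiX)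
  exact (α.coe_kummerEnd_unit hK _ (𝔉.muToBirat_mem_KxRootN u) x).symm

/-! ### Transport along `E^Π_N ⥲ Π^tp_Y[μ_N]`: "conjugation by `f`" is a Kummer cocycle shift -/

section Transport

variable (hK : 𝔉.KxRootNModCyclotome) (H : 𝔉.Facts) (T : ThetaEnvData.{v} 𝔉.N) (ι : 𝔉.PiX ≃ₜ* T.PiX)
  (m : 𝔉.muTorsion 𝔉.BN 𝔉.N ≃* T.mu) (hY : 𝔉.IdentifiesPiY T ι.toMulEquiv)
  (hχ : 𝔉.CyclotomicCharacterCompat T ι.toMulEquiv m)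

include hY hχ in
/-- The Kummer cocycle of `f ∈ (K^×)^{1/N}` read on `Π^tp_Y` (`kummerCocycleY`: `p ↦ m(κ_f(s^⊓-gp_N(ρ(ι⁻¹ p))))`) is
a 1-cocycle for the cyclotomic character (abc-iut-L2-t2's `CycEnvelope.IsEnvCocycle`): the cocycle law of
`κ_f` plus "`Π^tp_Y` acts on `μ_N(B_N)` via the cyclotomic character" (`CyclotomicCharacterCompat`).
[cite: MochizukiEtTh2009, Lem 5.8 proof p.331 (PDF p.105)] -/
theorem isEnvCocycle_kummerCocycleY (f : 𝔉.KxRootN) :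
    CycEnvelope.IsEnvCocycle T.augY T.chi (α.kummerCocycleY hK f T ι.toMulEquiv m) := by
  intro p q
  have hp : ι.symm (p : T.PiX) ∈ 𝔉.PiY :=
    (hY _).mpr (by change ι (ι.symm (p : T.PiX)) ∈ T.PiY; simp)
  rw [kummerCocycleY_apply, kummerCocycleY_apply, kummerCocycleY_apply]
  change m (α.kummerCocycle hK f (𝔉.sgpCap (𝔉.ρ (ι.symm ((p : T.PiX) * (q : T.PiX)))))) =
    m _ * T.chi (T.aug (p : T.PiX)) (m _)
  rw [map_mul, map_mul, map_mul, α.kummerCocycle_mul, map_mul]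
  congr 1
  have hιp : ι.toMulEquiv (ι.symm (p : T.PiX)) = (p : T.PiX) := ι.apply_symm_apply _
  have e4 := hχ (ι.symm (p : T.PiX)) hp
    (α.kummerCocycle hK f (𝔉.sgpCap (𝔉.ρ (ι.symm (q : T.PiX)))))
    (conjMu (𝔉.sgpCap (𝔉.ρ (ι.symm (p : T.PiX))))
      (α.kummerCocycle hK f (𝔉.sgpCap (𝔉.ρ (ι.symm (q : T.PiX)))))) rfl
  rw [hιp] at e4
  exact e4

/-- **Conjugation by `f` under `E^Π_N ⥲ Π^tp_Y[μ_N]`, elementwise**: `envIso(κ_f(e)⁻¹ ∘ e, y) =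
(a · m(κ_f(s^⊓-gp_N(ρ y)))⁻¹, ι y)` where `envIso(e, y) = (a, ι y)` — since `e ∈ μ_N(B_N) · s^⊓-gp_N(ρ y)` and
`κ_f` is trivial on `O^×(B_N)`.  [cite: MochizukiEtTh2009, Lem 5.9 (iv) p.332 (PDF p.106)] -/
theorem envIso_kummerEnd (f : 𝔉.KxRootN) (x : 𝔉.EPiN) :
    𝔉.envIso H T ι.toMulEquiv m hY hχ (α.kummerEnd hK f x) =
      ⟨(𝔉.envIso H T ι.toMulEquiv m hY hχ x).left *
          (m (α.kummerCocycle hK f (𝔉.sgpCap (𝔉.ρ x.1.2))))⁻¹,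
        (𝔉.envIso H T ι.toMulEquiv m hY hχ x).right⟩ := by
  have he : x.1.1 = (𝔉.unitPart H x : Aut 𝔉.BN) * 𝔉.sgpCap (𝔉.ρ x.1.2) := by
    rw [coe_unitPart, inv_mul_cancel_right]
  have hκ : α.kummerCocycle hK f x.1.1 = α.kummerCocycle hK f (𝔉.sgpCap (𝔉.ρ x.1.2)) := by
    rw [he]
    exact α.kummerCocycle_units_mul hK f (𝔉.muTorsion_le_units 𝔉.BN 𝔉.N (𝔉.unitPart H x).2) _
  have hu : 𝔉.unitPart H (α.kummerEnd hK f x) =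
      𝔉.unitPart H x * (α.kummerCocycle hK f (𝔉.sgpCap (𝔉.ρ x.1.2)))⁻¹ := by
    apply Subtype.ext
    rw [coe_unitPart, Subgroup.coe_mul, Subgroup.coe_inv, coe_unitPart, ← hκ]
    change (((α.kummerCocycle hK f x.1.1 : 𝔉.muTorsion 𝔉.BN 𝔉.N) : Aut 𝔉.BN))⁻¹ * x.1.1 *
        (𝔉.sgpCap (𝔉.ρ x.1.2))⁻¹ = _
    rw [mul_assoc]
    exact setLike_mul_comm (s := 𝔉.units 𝔉.BN)
      ((𝔉.units 𝔉.BN).inv_mem (𝔉.muTorsion_le_units 𝔉.BN 𝔉.N (α.kummerCocycle hK f x.1.1).2))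
      (𝔉.muTorsion_le_units 𝔉.BN 𝔉.N (𝔉.unitPart H x).2)
  ext
  · change m (𝔉.unitPart H (α.kummerEnd hK f x)) = m (𝔉.unitPart H x) * _
    rw [hu, map_mul, map_inv]
  · rfl

/-- **Conjugation by `f` IS a Kummer cocycle shift**: transport along `E^Π_N ≃ₜ* Π^tp_Y[μ_N]`
(`envContIso`) carries `kummerAutHom f` to abc-iut-L2-t2's `CycEnvelope.shift` by the inverse of the Kummer
cocycle of `f` read on `Π^tp_Y` — a generator of "the image of `K^×`" in `D_Y` (Def. 2.13 (i), p.273 (PDF p.47))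
once that cocycle is inflated from `G_K`.  [cite: MochizukiEtTh2009, Lem 5.9 (iv) p.332 (PDF p.106)] -/
theorem congr_kummerAutHom_eq_shift (f : 𝔉.KxRootN) :
    MulAut.congr (𝔉.envContIso H T ι m hY hχ).toMulEquiv (α.kummerAutHom hK f) =
      CycEnvelope.shift (α.isEnvCocycle_kummerCocycleY hK T ι m hY hχ f).inv := by
  apply MulEquiv.ext
  intro z
  obtain ⟨x, rfl⟩ := (𝔉.envContIso H T ι m hY hχ).surjective z
  change (𝔉.envContIso H T ι m hY hχ) (α.kummerAutHom hK f
      ((𝔉.envContIso H T ι m hY hχ).symm (𝔉.envContIso H T ι m hY hχ x))) = _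
  rw [ContinuousMulEquiv.symm_apply_apply]
  change 𝔉.envIso H T ι.toMulEquiv m hY hχ (α.kummerEnd hK f x) =
    ⟨(𝔉.envIso H T ι.toMulEquiv m hY hχ x).left *
        (α.kummerCocycleY hK f T ι.toMulEquiv m (𝔉.envIso H T ι.toMulEquiv m hY hχ x).right)⁻¹,
      (𝔉.envIso H T ι.toMulEquiv m hY hχ x).right⟩
  have hR : ι.toMulEquiv.symm ((𝔉.envIso H T ι.toMulEquiv m hY hχ x).right : T.PiX) = x.1.2 :=
    ι.symm_apply_apply x.1.2
  rw [α.envIso_kummerEnd hK H T ι m hY hχ f x, kummerCocycleY_apply, hR]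

/-- **One `K^×`-generator at a time**: if the Kummer cocycle of `f ∈ (K^×)^{1/N}` on `Π^tp_Y̲` is INFLATED FROM
`G_K` (`hinfl`: "`Π^tp_Y` [i.e., `G_K`, via the natural surjection `Π^tp_Y ↠ G_K`] acts" on `f`, proof of
Lemma 5.8 — `f^N ∈ K^×`, "`Y` is geometrically connected over `K`"; arithmetic, not proved here), the
transported outer automorphism "conjugation by `f`" lies in the Kummer part `kummerOut` of `D_Y`.
[cite: MochizukiEtTh2009, Lem 5.9 (iv) p.332 (PDF p.106)] -/
theorem transport_kummerOutHom_mem_kummerOut (f : 𝔉.KxRootN)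
    (hinfl : ∃ δ₀ : T.G → T.mu, ∀ (y : 𝔉.PiX), y ∈ 𝔉.PiY →
      m (α.kummerCocycle hK f (𝔉.sgpCap (𝔉.ρ y))) = δ₀ (T.aug (ι y))) :
    TopOut.transport (𝔉.envContIso H T ι m hY hχ) (α.kummerOutHom hK f) ∈ T.kummerOut := by
  obtain ⟨δ₀, hδ₀⟩ := hinfl
  have hpt : ∀ p : T.PiY, (α.kummerCocycleY hK f T ι.toMulEquiv m p)⁻¹ = (fun g => (δ₀ g)⁻¹) (T.augY p) := by
    intro p
    have hp : ι.symm (p : T.PiX) ∈ 𝔉.PiY :=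
      (hY _).mpr (by change ι (ι.symm (p : T.PiX)) ∈ T.PiY; simp)
    rw [kummerCocycleY_apply]
    change (m (α.kummerCocycle hK f (𝔉.sgpCap (𝔉.ρ (ι.symm (p : T.PiX))))))⁻¹ =
      (δ₀ (T.aug (p : T.PiX)))⁻¹
    rw [hδ₀ _ hp, ContinuousMulEquiv.apply_symm_apply]
  have hδ : CycEnvelope.IsEnvCocycle T.augY T.chi ((fun g => (δ₀ g)⁻¹) ∘ T.augY) :=
    (α.isEnvCocycle_kummerCocycleY hK T ι m hY hχ f).inv.congr hpt
  have key := α.congr_kummerAutHom_eq_shift hK H T ι m hY hχ f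
  have key' : MulAut.congr (𝔉.envContIso H T ι m hY hχ).toMulEquiv (α.kummerAutHom hK f) =
      CycEnvelope.shift hδ := by
    rw [key]
    apply MulEquiv.ext
    intro z
    ext
    · change z.left * (α.kummerCocycleY hK f T ι.toMulEquiv m z.right)⁻¹ =
        z.left * (fun g => (δ₀ g)⁻¹) (T.augY z.right)
      rw [hpt]
    · rfl
  have hc : CycEnvelope.shift hδ ∈ contMulAut T.env := by
    rw [← key']
    exact conjAut_mem_contMulAut _ (α.kummerAutHom_mem_contMulAut hK f)
  refine ⟨fun g => (δ₀ g)⁻¹, hδ, hc, ?_⟩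
  rw [kummerOutHom_apply]
  change TopOut.mk _ (conjContAut _ _) = TopOut.mk _ ⟨_, hc⟩
  congr 1
  exact Subtype.ext key'

/-- **The `K^×`-part of `D` goes into the Kummer part of `D_Y`** (given `hinfl` for all `f`). [cite: MochizukiEtTh2009, Lem 5.9 (iv) p.332 (PDF p.106)] -/
theorem image_kummerOut_subset_kummerOut
    (hinfl : ∀ f : 𝔉.KxRootN, ∃ δ₀ : T.G → T.mu, ∀ (y : 𝔉.PiX), y ∈ 𝔉.PiY →
      m (α.kummerCocycle hK f (𝔉.sgpCap (𝔉.ρ y))) = δ₀ (T.aug (ι y))) :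
    TopOut.transport (𝔉.envContIso H T ι m hY hχ) '' α.kummerOut hK ⊆ T.kummerOut := by
  rintro _ ⟨_, ⟨f, rfl⟩, rfl⟩
  exact α.transport_kummerOutHom_mem_kummerOut hK H T ι m hY hχ f (hinfl f)

/-- … hence into `D_Y`. [cite: MochizukiEtTh2009, Lem 5.9 (iv) p.332 (PDF p.106)] -/
theorem image_kummerOut_subset_DY
    (hinfl : ∀ f : 𝔉.KxRootN, ∃ δ₀ : T.G → T.mu, ∀ (y : 𝔉.PiX), y ∈ 𝔉.PiY →
      m (α.kummerCocycle hK f (𝔉.sgpCap (𝔉.ρ y))) = δ₀ (T.aug (ι y))) :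
    TopOut.transport (𝔉.envContIso H T ι m hY hχ) '' α.kummerOut hK ⊆ (T.DY : Set _) :=
  (α.image_kummerOut_subset_kummerOut hK H T ι m hY hχ hinfl).trans
    fun _ ho => Subgroup.subset_closure (Or.inl ho)

/-- **`ConstOutTransported` HOLDS at `DK := kummerOut`** (this seat's named hypothesis of
`Discharge/Sec5EnvelopeTopology.lean`: the transported `constOut ∪ DK` lies in `D_Y`), given the inflation input:
`constOut ⊆ kummerOut ↦ kummerOut(D_Y) ⊆ D_Y`.  [cite: MochizukiEtTh2009, Lem 5.9 (iv) p.332 (PDF p.106)] -/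
theorem constOutTransported_birat (h8 : 𝔉.ConstantsEqNormalizer)
    (hinfl : ∀ f : 𝔉.KxRootN, ∃ δ₀ : T.G → T.mu, ∀ (y : 𝔉.PiX), y ∈ 𝔉.PiY →
      m (α.kummerCocycle hK f (𝔉.sgpCap (𝔉.ρ y))) = δ₀ (T.aug (ι y))) :
    𝔉.ConstOutTransported H h8 (α.kummerOut hK) T ι m hY hχ := by
  have hsub : 𝔉.constOut h8 ∪ α.kummerOut hK ⊆ α.kummerOut hK :=
    Set.union_subset (α.constOut_subset_kummerOut hK h8) le_rfl
  exact (Set.image_mono hsub).trans (α.image_kummerOut_subset_DY hK H T ι m hY hχ hinfl)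

/-- **`KummerOutReached` HOLDS at `DK := kummerOut`** (this seat's named hypothesis of
`Discharge/Sec5EnvelopeTopology.lean`: every Kummer shift of `D_Y` — abc-iut-L2-t2's `kummerOut`, "the image of
`K^× ↠ (K^×)/(K^×)^N ⥲ H¹(G_K, μ_N) → H¹(Π^tp_Y, μ_N) → Out(Π^tp_Y[μ_N])`", p.273 (PDF p.47) — is reached from `D`),
given `hKum`: every `μ_N`-valued 1-cocycle of `G_K` is, up to a coboundary, the (inverse) Kummer cocycle of some
`f ∈ (K^×)^{1/N}` read through `(ι, m)` — print's "`⥲` is the Kummer map" (Kummer theory of `K`) with Lemma 5.8's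
"`(K^×)^{1/N}/μ_N(B_N) ⥲ K^×"; arithmetic, not proved here.  The coboundary is conjugation by an element of `μ_N`
(p.273: "corresponds precisely to modifying a cocycle by a coboundary"), trivial in `Out`.
[cite: MochizukiEtTh2009, Lem 5.9 (iv) p.332 (PDF p.106)] -/
theorem kummerOutReached_birat (h1 : 𝔉.SectionsFactor) (h3 : 𝔉.OuterActionLZ)
    (hsec : 𝔉.SgpCapSection) (hcs : 𝔉.SgpCupSection) (h8 : 𝔉.ConstantsEqNormalizer)
    (hKum : ∀ δ₀ : T.G → T.mu, CycEnvelope.IsEnvCocycle T.augY T.chi (δ₀ ∘ T.augY) →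
      ∃ (f : 𝔉.KxRootN) (a : T.mu), ∀ p : T.PiY,
        δ₀ (T.augY p) = (α.kummerCocycleY hK f T ι.toMulEquiv m p)⁻¹ * CycEnvelope.coboundary T.augY T.chi a p) :
    𝔉.KummerOutReached H h1 h3 hsec hcs h8 (α.kummerOut hK) T ι m hY hχ := by
  rintro o ⟨δ₀, hδ, hc, rfl⟩
  obtain ⟨f, a, hfa⟩ := hKum δ₀ hδ
  have hmem : α.kummerOutHom hK f ∈ (𝔉.frdBiThetaEnv h1 h3 hsec hcs h8 (α.kummerOut hK)).D :=
    Subgroup.subset_closure (Or.inr ⟨f, rfl⟩)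
  have key := α.congr_kummerAutHom_eq_shift hK H T ι m hY hχ f
  suffices heq : TopOut.mk T.env ⟨CycEnvelope.shift hδ, hc⟩ =
      TopOut.transport (𝔉.envContIso H T ι m hY hχ) (α.kummerOutHom hK f) by
    rw [heq]
    exact Subgroup.mem_map_of_mem _ hmem
  rw [kummerOutHom_apply]
  change TopOut.mk _ _ = TopOut.mk _ (conjContAut _ ⟨_, _⟩)
  refine QuotientGroup.eq.mpr ?_
  rw [Subgroup.mem_subgroupOf]
  refine ⟨CycEnvelope.inMu T.augY T.chi a⁻¹, ?_⟩
  apply MulEquiv.ext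
  intro z
  rw [CycEnvelope.conj_inMu_eq_shift_coboundary]
  change _ = (CycEnvelope.shift hδ).symm
    (MulAut.congr (𝔉.envContIso H T ι m hY hχ).toMulEquiv (α.kummerAutHom hK f) z)
  rw [key]
  ext
  · change z.left * CycEnvelope.coboundary T.augY T.chi a⁻¹ z.right =
      z.left * (α.kummerCocycleY hK f T ι.toMulEquiv m z.right)⁻¹ * ((δ₀ ∘ T.augY) z.right)⁻¹
    rw [Function.comp_apply, hfa z.right]
    simp only [CycEnvelope.coboundary, map_inv, mul_inv_rev, inv_inv]
    simp only [mul_assoc, mul_comm, mul_left_comm, mul_inv_cancel_left]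
  · rfl

end Transport

/-! ### Lemma 5.9 (iv) at the honest `DK := kummerOut` -/

section Assembly

variable (hK : 𝔉.KxRootNModCyclotome) (H : 𝔉.Facts) (h1 : 𝔉.SectionsFactor) (h3 : 𝔉.OuterActionLZ)
  (hsec : 𝔉.SgpCapSection) (hcs : 𝔉.SgpCupSection) (h8 : 𝔉.ConstantsEqNormalizer)
  (T : ThetaEnvData.{v} 𝔉.N) (ι : 𝔉.PiX ≃ₜ* T.PiX) (m : 𝔉.muTorsion 𝔉.BN 𝔉.N ≃* T.mu)
  (hY : 𝔉.IdentifiesPiY T ι.toMulEquiv) (hYdd : 𝔉.IdentifiesPiYdd T ι.toMulEquiv)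
  (hχX : 𝔉.CyclotomicCharacterCompatX T ι.toMulEquiv m)

include hY hχX in
/-- **[EtTh] Lemma 5.9 (iv) at the HONEST `K^×`-part**: abc-iut-L2-t4's named fact `EnvIsoBiTheta` — "the
natural inclusions `μ_N(B_N) ↪ E_N`, `Im(Π^tp_Y) ⊆ E_N` determine an isomorphism of topological groups
`E^Π_N ⥲ Π^tp_Y[μ_N]` which is an isomorphism of mod `N` bi-theta environments" (p.332 (PDF p.106)), for the
bi-theta environment on `E^Π_N` whose `D` is generated by `l·ℤ` (Lemma 5.9 (iii)), the constants and "conjugation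
by `(K^×)^{1/N}`" (`DK := kummerOut`, Lemma 5.8) — DISCHARGED MODULO: `Facts`, the identifications `ι`, `m`, the
cyclotomic-character dictionary on `Π^tp_X̲`, the Prop. 5.2 (iii) dictionary for a cocycle `η`, the birational
action `α` with `KxRootNModCyclotome`, and the two arithmetic inputs `hinfl` (Kummer cocycles of constants are
inflated from `G_K`) and `hKum` (Kummer surjectivity `K^× ↠ H¹(G_K, μ_N)` read through `(ι, m)`).
[cite: MochizukiEtTh2009, Lem 5.9 (iv) p.332 (PDF p.106)] -/
theorem envIsoBiTheta_birat {η : T.PiYdd → T.mu} (hη : η ∈ T.thetaCocycles)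
    (hcompat : 𝔉.ThetaSectionCompat H T ι.toMulEquiv m hYdd η)
    (hinfl : ∀ f : 𝔉.KxRootN, ∃ δ₀ : T.G → T.mu, ∀ (y : 𝔉.PiX), y ∈ 𝔉.PiY →
      m (α.kummerCocycle hK f (𝔉.sgpCap (𝔉.ρ y))) = δ₀ (T.aug (ι y)))
    (hKum : ∀ δ₀ : T.G → T.mu, CycEnvelope.IsEnvCocycle T.augY T.chi (δ₀ ∘ T.augY) →
      ∃ (f : 𝔉.KxRootN) (a : T.mu), ∀ p : T.PiY,
        δ₀ (T.augY p) = (α.kummerCocycleY hK f T ι.toMulEquiv m p)⁻¹ * CycEnvelope.coboundary T.augY T.chi a p) :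
    𝔉.EnvIsoBiTheta h1 h3 hsec hcs h8 (α.kummerOut hK) T ι :=
  𝔉.envIsoBiTheta_of H h1 h3 hsec hcs h8 (α.kummerOut hK) T ι m hY hYdd hχX hη hcompat
    (α.constOutTransported_birat hK H T ι m hY hχX.toY h8 hinfl)
    (α.kummerOutReached_birat hK H T ι m hY hχX.toY h1 h3 hsec hcs h8 hKum)

include hY hχX in
/-- **Lemma 5.9 (iv) "In particular" at the honest `K^×`-part**: the Frobenioid-theoretic data
`frdMonoThetaEnv … (DK := kummerOut)` IS a mod `N` mono-theta environment (abc-iut-L2-t4's `FrdIsMonoThetaEnv`),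
modulo the same hypotheses — the form in which layer L6 consumes §5 ([IUTchII] Prop. 1.2 (ii),
`exists_envOfFrobenioid_frdMonoThetaEnv`'s binder `hM`, with `DK` instantiated honestly).
[cite: MochizukiEtTh2009, Lem 5.9 (iv) p.332 (PDF p.106)] -/
theorem frdIsMonoThetaEnv_birat {η : T.PiYdd → T.mu} (hη : η ∈ T.thetaCocycles)
    (hcompat : 𝔉.ThetaSectionCompat H T ι.toMulEquiv m hYdd η)
    (hinfl : ∀ f : 𝔉.KxRootN, ∃ δ₀ : T.G → T.mu, ∀ (y : 𝔉.PiX), y ∈ 𝔉.PiY →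
      m (α.kummerCocycle hK f (𝔉.sgpCap (𝔉.ρ y))) = δ₀ (T.aug (ι y)))
    (hKum : ∀ δ₀ : T.G → T.mu, CycEnvelope.IsEnvCocycle T.augY T.chi (δ₀ ∘ T.augY) →
      ∃ (f : 𝔉.KxRootN) (a : T.mu), ∀ p : T.PiY,
        δ₀ (T.augY p) = (α.kummerCocycleY hK f T ι.toMulEquiv m p)⁻¹ * CycEnvelope.coboundary T.augY T.chi a p) :
    𝔉.FrdIsMonoThetaEnv h1 h3 hsec hcs h8 (α.kummerOut hK) T :=
  𝔉.frdIsMonoThetaEnv_of h1 h3 hsec hcs h8 (α.kummerOut hK) T ι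
    (α.envIsoBiTheta_birat hK H h1 h3 hsec hcs h8 T ι m hY hYdd hχX hη hcompat hinfl hKum)

end Assembly

end BiratAutAction

end ThetaFrobenioid

end Literature.AnabelianGeometry.EtaleTheta
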